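import Summits.KontsevichZagierPeriods.KontsevichZagierPeriods.Theorems.TerasomaMultiplicationBetaCancellationOfAyoubPiCancellation

/-!
# Crux stmt-KontsevichZagierPeriods-0540 (`AyoubSpecialisation.AyoubPiCancellation` ≡ `KZ.PiCancellation`),
# line `Sketch` (idea `moving-segment-wronskian`): stub `stub_spreadLift`

Support file (`--supports` stmt-KontsevichZagierPeriods-0540) of the line skeleton, registered stub
`stub_spreadLift` (S): the SPREAD (three leading coordinates) ANALOGUE of the tree theorem
`AyoubPiCancellationLine.stub_bandLift`
(`Theorems/LiouvilleUnfoldingAyoubPiCancellationStubBandLift.lean`).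

**Spread lift.** Let `a b` be rationals, `w : ℝ → ℝ` a weight of one real variable such that every
representation `r = [t, f]` of dimension `k + 1 ≥ 1` has the weighted companion `[t, w (z 0) · f]`,
let `V` be the pinned SPREAD family (`V n r` = the spread solid
`{a < z 0 < b, z 1² + z 2² ≤ 1, z 1 < z 0}` in the coordinates `0, 1, 2` times `r` in the trailing
`n` coordinates, integrand `g_r ∘ tail`), let `Vw` be the weighted spread solid
`[{a < z 0 < b, z 1² + z 2² ≤ 1, z 1 < z 0}, w (z 0)]` and let `M : FormalRep →+ FormalRep` be any
additive endomorphism sending the generator `[r]` of a representation of dimension `k + 1` to `[s]`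
whenever `s` is the weighted companion of `r`. Then on the spread family the multiplier computes the
weighted spread solid times `c`: `[Vw] * c − M (lift (of ∘ V) c) ∈ relations`.

Proof. Both sides are additive in `c` (`FreeAbelianGroup.induction_on`). On a generator `[t]`
(`t : IntegralRep m`), `M [V m t] = [s]` for the weighted companion `s` of `V m t`, and `s` EQUALS the
reindexed product `(Vw × t).reindex (Fin (3 + m) ≃ Fin (m + 3))` (`KZ.IntegralRep.ext'`: same domain
by the pinning, same integrand since the product integrand is `prodFun` unconditionally,
`KZ.IntegralRep.prod_integrand_eq`); finally `[Vw] * [t] = [Vw × t]` (`KZ.of_mul_of`) differs from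
its reindexing by one rule-(2) move (`KZ.of_sub_of_reindex_mem_relations`).
No definitions; sorry-free; axioms ⊆ {propext, Classical.choice, Quot.sound}.

References: M. Kontsevich, D. Zagier, *Periods* (2001), §1.2 rule (2), §4.1; J. Ayoub, *Une version
relative de la conjecture des périodes de Kontsevich–Zagier*, Ann. of Math. 181 (2015), §1.
-/

noncomputable section

-- `Summit.KontsevichZagierPeriods.KontsevichZagierPeriods.…` is the tree's mandated layout (single-conjunct summit).
set_option linter.dupNamespace false

namespace Summit.KontsevichZagierPeriods.KontsevichZagierPeriods.AyoubPiCancellationLine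

open Set
open Literature.NumberTheory.Transcendental
open Literature.NumberTheory.Transcendental.KZ

-- adapted from Summits/KontsevichZagierPeriods/KontsevichZagierPeriods/Theorems/LiouvilleUnfoldingAyoubPiCancellationStubBandLift.lean
-- (two leading coordinates replaced by three: wall position `z 0`, disc `z 1, z 2`, cut `z 1 < z 0`)

/-! ### The coordinate relabelling `Fin (3 + n) ≃ Fin (n + 3)` -/

/-- The relabelling `Fin (3 + n) ≃ Fin (n + 3)` on the wall-position coordinate. [folklore] -/
theorem spreadLift_idx_castAdd_zero (n : ℕ) :
    (finCongr (Nat.add_comm 3 n) (Fin.castAdd n (0 : Fin 3)) : Fin (n + 3)) = 0 :=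
  Fin.ext (by simp)

/-- The relabelling `Fin (3 + n) ≃ Fin (n + 3)` on the first disc coordinate. [folklore] -/
theorem spreadLift_idx_castAdd_one (n : ℕ) :
    (finCongr (Nat.add_comm 3 n) (Fin.castAdd n (1 : Fin 3)) : Fin (n + 3)) = 1 :=
  Fin.ext (by simp)

/-- The relabelling `Fin (3 + n) ≃ Fin (n + 3)` on the second disc coordinate. [folklore] -/
theorem spreadLift_idx_castAdd_two (n : ℕ) :
    (finCongr (Nat.add_comm 3 n) (Fin.castAdd n (2 : Fin 3)) : Fin (n + 3)) = 2 :=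
  Fin.ext (by simp [Nat.mod_eq_of_lt (show 2 < n + 3 by omega)])

/-- The relabelling `Fin (3 + n) ≃ Fin (n + 3)` on the trailing coordinates. [folklore] -/
theorem spreadLift_idx_natAdd (n : ℕ) (j : Fin n) :
    (finCongr (Nat.add_comm 3 n) (Fin.natAdd 3 j) : Fin (n + 3)) = j.succ.succ.succ :=
  Fin.ext (by simp only [finCongr_apply_coe, Fin.val_natAdd, Fin.val_succ]; omega)

/-! ### The weighted companion of the spread family is the reindexed `Vw × t` -/

/-- **The weighted companion of the spread family is the reindexed `Vw × t`**: if `s` has the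
domain of `V m t` and integrand `w (z 0) · (V m t).integrand z`, and `Vw` has the spread-solid
domain `{a < z 0 < b, z 1² + z 2² ≤ 1, z 1 < z 0}` and integrand `w (z 0)`, then
`s = (Vw × t).reindex (Fin (3 + m) ≃ Fin (m + 3))` (`KZ.IntegralRep.ext'`). [folklore] -/
theorem spreadLift_pinned_eq_reindex (a b : ℚ) (w : ℝ → ℝ)
    (V : ∀ n : ℕ, IntegralRep n → IntegralRep (n + 3))
    (hV : ∀ (n : ℕ) (r : IntegralRep n),
      (V n r).domain = {z : Fin (n + 3) → ℝ | ((a : ℝ) < z 0 ∧ z 0 < b) ∧ z 1 ^ 2 + z 2 ^ 2 ≤ 1 ∧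
        z 1 < z 0 ∧ (fun i : Fin n => z i.succ.succ.succ) ∈ r.domain} ∧
      (V n r).integrand = fun z => r.integrand (fun i : Fin n => z i.succ.succ.succ))
    {Vw : IntegralRep 3}
    (hVw : Vw.domain = {z : Fin 3 → ℝ | ((a : ℝ) < z 0 ∧ z 0 < b) ∧ z 1 ^ 2 + z 2 ^ 2 ≤ 1 ∧ z 1 < z 0})
    (hVw1 : Vw.integrand = fun z => w (z 0))
    (m : ℕ) (t : IntegralRep m) {s : IntegralRep (m + 3)}
    (hs : s.domain = (V m t).domain)
    (hsi : s.integrand = fun z => w (z 0) * (V m t).integrand z) :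
    s = (Vw.prod t).reindex (finCongr (Nat.add_comm 3 m)) := by
  refine IntegralRep.ext' ?_ ?_
  · rw [hs]
    ext z
    simp only [(hV m t).1, IntegralRep.reindex_domain, IntegralRep.prod_domain,
      IntegralRep.mem_prodDomain, hVw, mem_setOf_eq,
      spreadLift_idx_castAdd_zero, spreadLift_idx_castAdd_one, spreadLift_idx_castAdd_two,
      spreadLift_idx_natAdd, and_assoc]
  · rw [hsi]
    funext z
    simp only [(hV m t).2, IntegralRep.reindex_integrand, IntegralRep.prod_integrand_eq,
      IntegralRep.prodFun, hVw1, spreadLift_idx_castAdd_zero, spreadLift_idx_natAdd]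

/-! ### Spread lift: on the spread family the multiplier computes `[Vw] * c` -/

/-- STUB `stub_spreadLift` (S) of the line `Sketch`: on the pinned SPREAD family the weight
multiplier computes the weighted spread solid times `c`:
`[{a < q < b, x² + y² ≤ 1, x < q}, w(q)] * c − M (lift (of ∘ V) c) ∈ relations` (spread analogue of
`stub_bandLift`: both sides additive in `c`; on a generator `[t]`, `M [V t]` is the reindexed
`[V_w × t] = [V_w] * [t]`, one rule-(2) relabelling `KZ.of_sub_of_reindex_mem_relations`).
[folklore] -/
theorem stub_spreadLift : ∀ (a b : ℚ) (w : ℝ → ℝ),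
    (∀ (k : ℕ) (r : IntegralRep (k + 1)),
      ∃ s : IntegralRep (k + 1), s.domain = r.domain ∧ s.integrand = fun z => w (z 0) * r.integrand z) →
    ∀ (V : ∀ n : ℕ, IntegralRep n → IntegralRep (n + 3)),
      (∀ (n : ℕ) (r : IntegralRep n),
        (V n r).domain = {z : Fin (n + 3) → ℝ | ((a : ℝ) < z 0 ∧ z 0 < b) ∧ z 1 ^ 2 + z 2 ^ 2 ≤ 1 ∧
          z 1 < z 0 ∧ (fun i : Fin n => z i.succ.succ.succ) ∈ r.domain} ∧
        (V n r).integrand = fun z => r.integrand (fun i : Fin n => z i.succ.succ.succ)) →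
    ∀ (Vw : IntegralRep 3),
      Vw.domain = {z : Fin 3 → ℝ | ((a : ℝ) < z 0 ∧ z 0 < b) ∧ z 1 ^ 2 + z 2 ^ 2 ≤ 1 ∧ z 1 < z 0} →
      (Vw.integrand = fun z => w (z 0)) →
    ∀ (M : FormalRep →+ FormalRep),
      (∀ (k : ℕ) (r s : IntegralRep (k + 1)), s.domain = r.domain →
          (s.integrand = fun z => w (z 0) * r.integrand z) → M (of r) = of s) →
      ∀ c : FormalRep,
        of Vw * c - M (FreeAbelianGroup.lift (fun s : (Σ n, IntegralRep n) => of (V s.1 s.2)) c) ∈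
          relations := by
  intro a b w hex V hV Vw hVw hVw1 M hpin c
  induction c using FreeAbelianGroup.induction_on with
  | zero => simp [relations.zero_mem]
  | of x =>
    obtain ⟨m, t⟩ := x
    rw [FreeAbelianGroup.lift_apply_of]
    obtain ⟨s, hs, hsi⟩ := hex (m + 2) (V m t)
    change of Vw * of t - M (of (V m t)) ∈ relations
    rw [hpin (m + 2) (V m t) s hs hsi, spreadLift_pinned_eq_reindex a b w V hV hVw hVw1 m t hs hsi,
      of_mul_of]
    exact of_sub_of_reindex_mem_relations _ _
  | neg x ih =>
    rw [mul_neg, map_neg, map_neg, ← neg_sub']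
    exact relations.neg_mem ih
  | add x y hx hy =>
    rw [mul_add, map_add, map_add, ← sub_add_sub_comm]
    exact relations.add_mem hx hy

end Summit.KontsevichZagierPeriods.KontsevichZagierPeriods.AyoubPiCancellationLine
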